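import Summits.QuantumFields.YangMills.Theorems.TemperedCurvatureMoments.Negative.TieLoadBearing
import Summits.QuantumFields.YangMills.Theorems.IsotropyFromPowerCountingCurvatureDensitiesTameSector

/-!
# `TemperedCurvatureMoments` (T, stmt-QuantumFields-17721) — negative side II: no counterexample on the
# EVENTUALLY-TAME sector; T is equivalent to its restriction to the frequently-wild sector

Disprover (cdisprove) support file for the item `IsotropyFromPowerCounting.TemperedCurvatureMoments` (T), sequel of
`Negative/TieLoadBearing.lean` (p141448: the Wilson tie at order 4 is load-bearing; the model-blind core is false).

Where can a counterexample to T live?  T is universally quantified over ALL sequential Wilson schemes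
`sch = (a_k, β_k, L_k, c_k, m_k)` and every compact simple `G`, `r`.  The certified inhabitants of the tie are the
TAME steps: zero coupling (`β_k = 0`, product Haar: the centred torus moments of the action density at
torus-distinct sites are the moments of a CONSTANT, landed `torusMoment_zero_coupling`) and bounded multiplicative
renormalisation (`|c_k| ≤ B`, landed `abs_trueDensity_le`).  This file certifies that NO scheme that is eventually
tame can refute T, whatever the additive counterterms `m_k` and — at zero-coupling steps — WHATEVER `c_k`
(super-exponential growth included):

* `temperedApproximants_of_eventually_tame` — tie + `∃ B, ∀ᶠ k, β_k = 0 ∨ |c_k| ≤ B` ⇒ the degree-`n` conclusion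
  of T (`TemperedApproximants sch.a sch.L S₁ n`, with `N = 0`), witness the TRUE density `c_kⁿ W_k`;
  corollaries `…_of_eventually_zero_coupling` (any `c_k, m_k`) and `…_of_eventually_abs_c_le`;
* `frequently_wild_of_not_temperedApproximants` — contrapositive: a tied family violating the degree-`n`
  conclusion forces, for EVERY bound `B`, infinitely many steps `k` with `β_k ≠ 0` AND `|c_k| > B` simultaneously;
* `temperedCurvatureMoments_eventuallyTameSector` — the item with the one extra tameness hypothesis, PROVED;
* `temperedCurvatureMoments_iff_wildSector` — T is EQUIVALENT to its restriction to schemes with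
  `∀ B, ∃ᶠ k, β_k ≠ 0 ∧ B < |c_k|` (non-zero coupling and unbounded renormalisation at the SAME steps,
  infinitely often) — the regime of the weak-coupling continuum limit (`c_k ≍ a_k⁻⁴` for `tr F²`), where no
  Wilson limit is constructed.

Compared with the Step-0 corollary `CurvatureDensities` (landed `curvatureDensities_iff_wildSector`: FREQUENTLY
tame suffices there, by passing to a subsequence), T is k-UNIFORM, so only EVENTUAL tameness is absorbed here; the
gap between the two (tame along a subsequence, wild along another) is genuine for T as typed and is recorded in the
disprover's work file.  Only the tie of `W1` is used; E0, the eight frames, the cone and both gaps are idle.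

References: K. Osterwalder, E. Seiler, Ann. Phys. 110 (1978) §2; J. Glimm, A. Jaffe, Quantum Physics (1987) §6.1,
Cor. 19.5.6; A. Jaffe, E. Witten (2000) §6.
-/

noncomputable section

-- Mathlib's `SimplexCategory` instance `Fintype (Fin (x.len + 1))` matches `Fintype (Fin 4)` (tree-known
-- workaround, cf. the imported support files).
attribute [-instance] SimplexCategory.instFintypeToTypeOrderHomFinHAddNatLenOfNat

namespace Summit.QuantumFields.YangMills.Theorems.TemperedCurvatureMoments.Negative

open scoped BigOperators SchwartzMap
open MeasureTheory Filter Topology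
open Literature.MathematicalPhysics.QuantumLattice Literature.MathematicalPhysics.AQFT
  Literature.MathematicalPhysics.QuantumFieldTheory
open Literature.Probability.LatticeModels (box Site Torus.proj)
open Summit.QuantumFields.YangMills.Theorems.NPointIsotropy.Negative (E4)
open Summit.QuantumFields.YangMills.Theorems.CurvatureBoostCovariance.Negative
  (Tie W1 EightFrameRP PlanarCone haarTraceRe proj_injOn_box eventually_lt_side)
open Summit.QuantumFields.YangMills.Theorems.OSLegsFromFemtoAndGap (torusMoment)
open Summit.QuantumFields.YangMills.Theorems.SoftKernelBoostCovariance.Sketch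
  (temperedCurvatureMoments_of_trueDensity_tempered eventually_abs_renormalisedMean_le abs_trueDensity_le)
open Summit.QuantumFields.YangMills.Theorems.CurvatureDensities
  (torusMoment_zero_coupling wilsonTorusMean_zero_coupling)
open Summit.QuantumFields.YangMills.Theses.IsotropyFromPowerCounting (TemperedCurvatureMoments)

variable {G : Type} [Group G] [TopologicalSpace G] [IsTopologicalGroup G] [CompactSpace G]
  [MeasurableSpace G] [BorelSpace G]

/-! ## T on the eventually-tame sector -/

/-- **The degree-`n` conclusion of T on every EVENTUALLY-TAME scheme.**  Let `S₁` be tied to `(r, sch)` (first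
clause of `W1`) and suppose that for some `B`, for all large `k`, `β_k = 0` or `|c_k| ≤ B`.  Then
`TemperedApproximants sch.a sch.L S₁ n` for every `n ≥ 1`, with the true renormalised Wilson density `c_kⁿ W_k` as
witness and `N = 0`: at zero-coupling steps `c_kⁿ W_k ≡ κ_kⁿ` on injective multi-sites of the box (`κ_k` the
renormalised mean, bounded by the degree-one tie), at bounded-`c` steps `|c_kⁿ W_k| ≤ (2BM + K)ⁿ`. -/
theorem temperedApproximants_of_eventually_tame (r : LatticeRep G) (sch : SpeciesScheme (YMSpecies G))
    (S₁ : SchwingerFamily E4) (htie : Tie r sch S₁)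
    (h : ∃ B : ℝ, ∀ᶠ k in atTop, sch.β k = 0 ∨ |sch.c r.curvature k| ≤ B) {n : ℕ} (hn : 0 < n) :
    TemperedApproximants sch.a sch.L S₁ n := by
  obtain ⟨B, hB⟩ := h
  obtain ⟨k₃, hk₃⟩ := eventually_atTop.1 hB
  obtain ⟨M, hM⟩ := r.curvature.bounded
  obtain ⟨K, hK⟩ := eventually_abs_renormalisedMean_le r sch S₁ htie
  obtain ⟨k₁, hk₁⟩ := eventually_atTop.1 hK
  obtain ⟨k₂, hk₂⟩ := eventually_atTop.1 (eventually_lt_side sch n)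
  refine temperedCurvatureMoments_of_trueDensity_tempered r sch S₁ htie hn
    ⟨|2 * B * M + K| ^ n + |K| ^ n + 1, 0, max (max k₁ k₂) k₃, by positivity, fun k hk x hx hxinj => ?_⟩
  have hk1 : k₁ ≤ k := ((le_max_left _ _).trans (le_max_left _ _)).trans hk
  have hk2 : k₂ ≤ k := ((le_max_right _ _).trans (le_max_left _ _)).trans hk
  have hk3 : k₃ ≤ k := (le_max_right _ _).trans hk
  have hKn : 0 ≤ |K| ^ n := pow_nonneg (abs_nonneg _) n
  have hBn : 0 ≤ |2 * B * M + K| ^ n := pow_nonneg (abs_nonneg _) n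
  simp only [pow_zero, mul_one]
  rcases hk₃ k hk3 with hβ | hc
  · -- a zero-coupling step: the true density is the constant `κ_kⁿ` on injective box multi-sites
    have hside : n < 2 * sch.L k + 1 := hk₂ k hk2
    have hL : 0 < sch.L k := by omega
    have hinj' : Function.Injective fun i => Torus.proj (2 * sch.L k + 1) (x i) :=
      fun i j hij => hxinj (proj_injOn_box (sch.L k) (hx i) (hx j) hij)
    have hκ := hk₁ k hk1
    rw [hβ, wilsonTorusMean_zero_coupling r hL] at hκ
    rw [hβ, torusMoment_zero_coupling r (sch.L k) _ x hinj' hside, ← mul_pow, abs_pow]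
    calc |sch.c r.curvature k * (6 * haarTraceRe r.ρ - sch.m r.curvature k)| ^ n
        ≤ |K| ^ n := pow_le_pow_left₀ (abs_nonneg _) (hκ.trans (le_abs_self K)) n
      _ ≤ |2 * B * M + K| ^ n + |K| ^ n + 1 := by linarith
  · -- a bounded-renormalisation step
    calc |sch.c r.curvature k ^ n *
            torusMoment r.ρ (sch.β k) (sch.L k) r.curvature.F (sch.m r.curvature k) x|
        ≤ (2 * B * M + K) ^ n := abs_trueDensity_le r sch hM k hc (hk₁ k hk1) x
      _ ≤ |2 * B * M + K| ^ n := by rw [← abs_pow]; exact le_abs_self _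
      _ ≤ |2 * B * M + K| ^ n + |K| ^ n + 1 := by linarith

/-- **No counterexample from ANY scheme at zero coupling eventually — whatever `c_k, m_k`.**  (The `β ≡ 0`
collapse for T itself: independent Haar links make the curvature a c-number field `κ_k` on injective multi-sites,
and the degree-one tie bounds `κ_k`; `c_k` may grow arbitrarily fast.) -/
theorem temperedApproximants_of_eventually_zero_coupling (r : LatticeRep G) (sch : SpeciesScheme (YMSpecies G))
    (S₁ : SchwingerFamily E4) (htie : Tie r sch S₁) (hβ : ∀ᶠ k in atTop, sch.β k = 0) {n : ℕ} (hn : 0 < n) :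
    TemperedApproximants sch.a sch.L S₁ n :=
  temperedApproximants_of_eventually_tame r sch S₁ htie ⟨0, hβ.mono fun _ hk => Or.inl hk⟩ hn

/-- **No counterexample from any scheme with eventually bounded multiplicative renormalisation** (the landed
`∀ k, |c_k| ≤ B` sector of p140303, with `∀` relaxed to `∀ᶠ`). -/
theorem temperedApproximants_of_eventually_abs_c_le (r : LatticeRep G) (sch : SpeciesScheme (YMSpecies G))
    (S₁ : SchwingerFamily E4) (htie : Tie r sch S₁) (hc : ∃ B : ℝ, ∀ᶠ k in atTop, |sch.c r.curvature k| ≤ B)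
    {n : ℕ} (hn : 0 < n) : TemperedApproximants sch.a sch.L S₁ n := by
  obtain ⟨B, hB⟩ := hc
  exact temperedApproximants_of_eventually_tame r sch S₁ htie ⟨B, hB.mono fun _ hk => Or.inr hk⟩ hn

/-! ## Where an obstruction must live -/

/-- **An obstruction to T forces wild steps infinitely often.**  If `S₁` is tied to `(r, sch)` and the degree-`n`
conclusion of T FAILS, then for every bound `B` there are infinitely many steps `k` with `β_k ≠ 0` and `|c_k| > B`
AT THE SAME TIME. -/
theorem frequently_wild_of_not_temperedApproximants (r : LatticeRep G) (sch : SpeciesScheme (YMSpecies G))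
    (S₁ : SchwingerFamily E4) (htie : Tie r sch S₁) {n : ℕ} (hn : 0 < n)
    (h : ¬ TemperedApproximants sch.a sch.L S₁ n) (B : ℝ) :
    ∃ᶠ k in atTop, sch.β k ≠ 0 ∧ B < |sch.c r.curvature k| := by
  by_contra hnot
  refine h (temperedApproximants_of_eventually_tame r sch S₁ htie ⟨B, ?_⟩ hn)
  rw [Filter.not_frequently] at hnot
  refine hnot.mono fun k hk => ?_
  by_cases hβ : sch.β k = 0
  · exact Or.inl hβ
  · exact Or.inr (not_lt.1 fun hlt => hk ⟨hβ, hlt⟩)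

/-! ## The item on the eventually-tame sector; reduction of the item to the wild sector -/

/-- **`TemperedCurvatureMoments` ON THE EVENTUALLY-TAME SECTOR** — the item with one extra hypothesis: for every
compact simple `G`, `r`, `sch`, `S₁` with `W1 r sch S₁` (only the tie is used), the eight frames and the cone (idle),
IF for all large `k` the scheme is at zero coupling or has `|c_k| ≤ B`, then the conclusion of T holds in every
degree `n ≥ 1`. -/
theorem temperedCurvatureMoments_eventuallyTameSector :
    ∀ (G : Type) [Group G] [TopologicalSpace G] [IsTopologicalGroup G] [CompactSpace G]
      [MeasurableSpace G] [BorelSpace G], IsCompactSimpleLieGroup G →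
      ∀ (r : LatticeRep G) (sch : SpeciesScheme (YMSpecies G)) (S₁ : SchwingerFamily E4),
        W1 r sch S₁ → EightFrameRP S₁ → PlanarCone S₁ →
        (∃ B : ℝ, ∀ᶠ k in atTop, sch.β k = 0 ∨ |sch.c r.curvature k| ≤ B) →
        ∀ n : ℕ, 0 < n → TemperedApproximants sch.a sch.L S₁ n :=
  fun _G _ _ _ _ _ _ _ r sch S₁ hW _ _ h _n hn => temperedApproximants_of_eventually_tame r sch S₁ hW.1 h hn

/-- **T is equivalent to its restriction to the WILD SECTOR** `∀ B, ∃ᶠ k, β_k ≠ 0 ∧ B < |c_k|` (non-zero coupling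
and unbounded multiplicative renormalisation at the same steps, infinitely often — the regime of the weak-coupling
continuum limit with the physical `c_k ≍ a_k⁻⁴`): every other scheme is covered by
`temperedCurvatureMoments_eventuallyTameSector`.  A refutation of T therefore requires a Wilson scaling limit of the
`tr F²` strings along such a scheme — none is constructed. -/
theorem temperedCurvatureMoments_iff_wildSector :
    TemperedCurvatureMoments ↔
      ∀ (G : Type) [Group G] [TopologicalSpace G] [IsTopologicalGroup G] [CompactSpace G]
        [MeasurableSpace G] [BorelSpace G], IsCompactSimpleLieGroup G →
        ∀ (r : LatticeRep G) (sch : SpeciesScheme (YMSpecies G)) (S₁ : SchwingerFamily E4),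
          W1 r sch S₁ → EightFrameRP S₁ → PlanarCone S₁ →
          (∀ B : ℝ, ∃ᶠ k in atTop, sch.β k ≠ 0 ∧ B < |sch.c r.curvature k|) →
          ∀ n : ℕ, 0 < n → TemperedApproximants sch.a sch.L S₁ n := by
  rw [temperedCurvatureMoments_iff]
  constructor
  · intro h G _ _ _ _ _ _ hG r sch S₁ hW h8 hC _ n hn
    exact h G hG r sch S₁ hW h8 hC n hn
  · intro h G _ _ _ _ _ _ hG r sch S₁ hW h8 hC n hn
    by_contra hT
    exact hT (h G hG r sch S₁ hW h8 hC (frequently_wild_of_not_temperedApproximants r sch S₁ hW.1 hn hT) n hn)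

end Summit.QuantumFields.YangMills.Theorems.TemperedCurvatureMoments.Negative

end
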